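import Mathlib
import Summits.MatrixMultiplication.MatrixMultiplication.Theorems.SnSubsetDichotomyNoThresholdSubsetTriplePlancherelStepDefs

/-!
# The J-increment is bounded by the bounding box (route `SnSubsetDichotomy`, crux `NoThresholdSubsetTriple`)

Stub `abs_incr_le_of_bounded` (the (L2)-absolute ingredient of the lead-c7 report, app. A) of line
`klr-graded-polynomial-method` (stmt-MatrixMultiplication-8302).

For ANY finite cell set `ν ⊆ ℕ × ℕ` (no Young-diagram hypothesis) all of whose cells have row index
`< R` and column index `< K`, and any cell `y`,

  `|x_y| ≤ R + K`,

where `x_y = R(row y) − C(col y)` is `PlancherelStep.incr`.  Pure bookkeeping: every parity charge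
`χ_i = (−1)^i [row i odd]` lies in `{0, ±1}` and is nonzero only on a NONEMPTY row, i.e. on a row
index `i < R`; hence any tail sum of the `χ_i` has absolute value at most `#{i | i < R} = R`
(`abs_sum_le_of_support_lt`).  Likewise the column tails are bounded by `K`, and
`|a − b| ≤ |a| + |b|` finishes.
-/

open scoped BigOperators

namespace Summit.MatrixMultiplication.MatrixMultiplication.Theorems

open PlancherelStep

set_option linter.dupNamespace false in
/-- A finite sum of integers of absolute value `≤ 1`, all of whose nonzero terms have index `< R`,
has absolute value at most `R`. -/
private theorem abs_sum_le_of_support_lt (s : Finset ℕ) (f : ℕ → ℤ) (R : ℕ)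
    (hf : ∀ i, |f i| ≤ 1) (hR : ∀ i, f i ≠ 0 → i < R) : |∑ i ∈ s, f i| ≤ (R : ℤ) :=
  calc |∑ i ∈ s, f i| ≤ ∑ i ∈ s, |f i| := Finset.abs_sum_le_sum_abs _ _
    _ ≤ ∑ i ∈ s, (if i < R then (1 : ℤ) else 0) := by
        refine Finset.sum_le_sum fun i _ => ?_
        split_ifs with h
        · exact hf i
        · rw [not_not.mp fun hne => h (hR i hne), abs_zero]
    _ = ((s.filter (fun i => i < R)).card : ℤ) := by rw [Finset.sum_boole]
    _ ≤ (R : ℤ) := by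
        have h : s.filter (fun i => i < R) ⊆ Finset.range R := fun i hi =>
          Finset.mem_range.mpr (Finset.mem_filter.mp hi).2
        exact_mod_cast (Finset.card_le_card h).trans_eq (Finset.card_range R)

set_option linter.dupNamespace false in
/-- Each row-parity charge `χ_i ∈ {0, ±1}` has absolute value at most one. -/
private theorem abs_rowCharge_le_one' (ν : Finset (ℕ × ℕ)) (i : ℕ) : |rowCharge ν i| ≤ 1 := by
  unfold rowCharge
  split_ifs
  · exact (abs_neg_one_pow i).le
  · simp

set_option linter.dupNamespace false in
/-- Each column-parity charge `χ^c_j ∈ {0, ±1}` has absolute value at most one. -/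
private theorem abs_colCharge_le_one' (ν : Finset (ℕ × ℕ)) (j : ℕ) : |colCharge ν j| ≤ 1 := by
  unfold colCharge
  split_ifs
  · exact (abs_neg_one_pow j).le
  · simp

set_option linter.dupNamespace false in
/-- A nonzero row charge sits on a row of odd, hence positive, length, so the row contains a cell;
if every cell has row index `< R` then so does this row. -/
private theorem lt_of_rowCharge_ne_zero {ν : Finset (ℕ × ℕ)} {R : ℕ} (hR : ∀ x ∈ ν, x.1 < R)
    {i : ℕ} (h : rowCharge ν i ≠ 0) : i < R := by
  unfold rowCharge at h
  split_ifs at h with hodd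
  · obtain ⟨x, hx⟩ := Finset.card_pos.mp (hodd.pos : 0 < (ν.filter fun c => c.1 = i).card)
    rw [Finset.mem_filter] at hx
    exact hx.2 ▸ hR x hx.1
  · exact absurd rfl h

set_option linter.dupNamespace false in
/-- A nonzero column charge sits on a column of odd, hence positive, length, so the column contains
a cell; if every cell has column index `< K` then so does this column. -/
private theorem lt_of_colCharge_ne_zero {ν : Finset (ℕ × ℕ)} {K : ℕ} (hK : ∀ x ∈ ν, x.2 < K)
    {j : ℕ} (h : colCharge ν j ≠ 0) : j < K := by
  unfold colCharge at h
  split_ifs at h with hodd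
  · obtain ⟨x, hx⟩ := Finset.card_pos.mp (hodd.pos : 0 < (ν.filter fun c => c.2 = j).card)
    rw [Finset.mem_filter] at hx
    exact hx.2 ▸ hK x hx.1
  · exact absurd rfl h

set_option linter.dupNamespace false in
/-- **Bounded rows/columns ⇒ bounded increments.** If every cell of the finite cell set `ν` has
row index `< R` and column index `< K`, then `|x_y| ≤ R + K` for every cell `y`: the tail
`R(row y)` of the `{0, ±1}`-valued row charges has at most `R` nonzero terms (one per nonempty
row), the tail `C(col y)` of the column charges at most `K`, and `x_y = R(row y) − C(col y)`.
[folklore] -/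
theorem abs_incr_le_of_bounded : ∀ (ν : Finset (ℕ × ℕ)) (R K : ℕ),
    (∀ x ∈ ν, x.1 < R ∧ x.2 < K) → ∀ (y : ℕ × ℕ), |incr ν y| ≤ ((R + K : ℕ) : ℤ) := by
  intro ν R K hν y
  unfold incr chargeBelow chargeRight
  rw [Nat.cast_add]
  exact (abs_sub _ _).trans (add_le_add
    (abs_sum_le_of_support_lt _ _ R (abs_rowCharge_le_one' ν)
      fun i hi => lt_of_rowCharge_ne_zero (fun x hx => (hν x hx).1) hi)
    (abs_sum_le_of_support_lt _ _ K (abs_colCharge_le_one' ν)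
      fun j hj => lt_of_colCharge_ne_zero (fun x hx => (hν x hx).2) hj))

end Summit.MatrixMultiplication.MatrixMultiplication.Theorems
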